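import Literature.Probability.RandomPlanarGeometry.SAWPolygonConcatenation
import Literature.Probability.RandomPlanarGeometry.SAWBridges
import HarnessLib

/-!
# Polygons are outnumbered by bridges: `q_N ≤ (d-1) b_N(w)` (Madras–Slade Proposition 8.1.2)

Topic `Literature/Probability/RandomPlanarGeometry` (continues `SAWPolygonConcatenation.lean`: `q_N = polygonNumber d N`,
the half-space classes `Q_I[N] = halfLoops d N I` and (3.2.4) `q_N ≤ (d-1) #Q_I[N]`; `SAWBridges.lean`: `bridges d N`,
`b_N = bridgeCount d N`). Source: N. Madras, G. Slade, *The Self-Avoiding Walk* (1993), §8.1, Definition 8.1.1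
(p. 259: `b_N(y)`, the bridges with prescribed transverse endpoint `y ∈ ℤ^{d-1}`) and Proposition 8.1.2 (p. 260) with its
proof (pp. 260–262; Figure 8.1, p. 261: "changing a polygon into a bridge by reflecting a piece through the hyperplane
`x₁ = M`"). Status in print: Proposition 8.1.2 is printed with constant `d(d-1)` for even `N ≥ 4`; the constant `d-1` here
comes from combining the printed (3.2.4) (p. 64) with the printed (8.1.23) (p. 262) — CONSOLIDATION (lit-2 g16, 2026-08-23).

## Contents (namespace `Literature.Probability.RandomPlanarGeometry.SAW.Zd`; all PROVED, no named facts)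
* `bridgeEndCount d N y = b_N(y)`: the `N`-step bridges `ζ` from `0` with `(ζ₂(N), …, ζ_d(N)) = (y₂, …, y_d)`
  (Definition 8.1.1; the first coordinate of `y` is ignored), `bridgeEndCount_le_bridgeCount : b_N(y) ≤ b_N`.
* `PolygonBridge.unfold N υ`: the map of the proof of Proposition 8.1.2 — reflect the piece of the loop after its
  first visit to its maximal hyperplane `x₁ = M` through that hyperplane and prepend one step `e₁`;
  `unfold_mem` (the image of `Q_I[N]` consists of bridges ending at transverse position `e_I`), `unfold_injOn`.
* **`card_halfLoops_le_bridgeEndCount : #Q_I[N] ≤ b_N(e_I)`** and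
  **`MadrasSlade1993_prop812 : q_N ≤ (d-1) · b_N(e_I)`** (`N ≥ 3`, `I ≠ 0`) — Proposition 8.1.2, eq. (8.1.19),
  with the constant `d-1` in place of the printed `d(d-1)` (the tree's (3.2.4) replaces the cruder (8.1.20));
  corollaries `polygonNumber_le_mul_bridgeCount : q_N ≤ (d-1) b_N` and, in the plane,
  `polygonNumber_two_le_bridgeCount : q_N ≤ b_N`.
-/

noncomputable section

open Finset Literature.Probability.LatticeModels Literature.Probability.Percolation SimpleGraph

namespace Literature.Probability.RandomPlanarGeometry.SAW.Zd

open PolygonConcat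

variable {d : ℕ}

open Classical in
/-- **`b_N(y)`** (Madras–Slade Definition 8.1.1): the number of `N`-step bridges `ζ` with `ζ(0) = 0` and
`(ζ₂(N), …, ζ_d(N)) = y` — here `y : ℤ^d` and its first coordinate is ignored.
[cite: MadrasSlade1993, Definition 8.1.1 (p. 259)] -/
def bridgeEndCount (d : ℕ) [NeZero d] (N : ℕ) (y : Site d) : ℕ :=
  ((bridges d N).filter fun ζ => ∀ j : Fin d, j ≠ 0 → ζ N j = y j).card

/-- `b_N(y) ≤ b_N`. [cite: MadrasSlade1993, Definition 8.1.1 (p. 259: `b_N(y) = Σ_L b_{N,L}(y)`)] -/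
theorem bridgeEndCount_le_bridgeCount [NeZero d] (N : ℕ) (y : Site d) :
    bridgeEndCount d N y ≤ bridgeCount d N := by
  classical
  rw [bridgeEndCount, bridgeCount]
  exact card_filter_le _ _

namespace PolygonBridge

variable [NeZero d]

/-! ### Unfolded membership facts -/

omit [NeZero d] in
/-- A loop of `saLoops d N`: root `0`, frozen after `N`, nearest-neighbour steps, closed, injective on `[0, N)`.
[folklore] -/
private theorem loop_facts {N : ℕ} {ω : ℕ → Site d} (hω : ω ∈ saLoops d N) :
    ω 0 = 0 ∧ (∀ i, N ≤ i → ω i = ω N) ∧ (∀ i < N, (zdGraph d).Adj (ω i) (ω (i + 1))) ∧ ω N = 0 ∧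
      Set.InjOn ω {i | i < N} := by
  classical
  rw [mem_saLoops, nnWalks, Finset.mem_filter] at hω
  obtain ⟨⟨hfr, h0, hadj⟩, hN, hinj⟩ := hω
  rw [frozenFns, Finset.mem_image] at hfr
  obtain ⟨f, -, hf⟩ := hfr
  refine ⟨h0, fun i hi => ?_, hadj, hN, hinj⟩
  rw [← hf]; simp only [min_eq_right hi, min_self]

/-- Membership in `Q_I[N] = halfLoops d N I`. [folklore] -/
private theorem mem_halfLoops' {N : ℕ} {I : Fin d} {υ : ℕ → Site d} :
    υ ∈ halfLoops d N I ↔ υ ∈ saLoops d N ∧ (∀ j, 0 ≤ υ j 0) ∧ υ (N - 1) = ee I := by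
  classical
  rw [halfLoops, Finset.mem_filter]

/-! ### Reflection through the hyperplane `x₁ = M` -/

/-- `T_M`: reflection of `ℤ^d` through the hyperplane `x₁ = M`. [cite: MadrasSlade1993, Proposition 8.1.2 (proof: `T_M`)] -/
def refl (M : ℤ) (v : Site d) : Site d := fun j => if j = 0 then 2 * M - v 0 else v j

/-- First coordinate of the reflection. [folklore] -/
@[simp] private theorem refl_zero (M : ℤ) (v : Site d) : refl M v 0 = 2 * M - v 0 := by simp [refl]

/-- The other coordinates are unchanged. [folklore] -/
private theorem refl_ne (M : ℤ) (v : Site d) {j : Fin d} (hj : j ≠ 0) : refl M v j = v j := by simp [refl, hj]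

/-- `T_M` is an involution. [folklore] -/
private theorem refl_refl (M : ℤ) (v : Site d) : refl M (refl M v) = v := by
  funext j; by_cases hj : j = 0
  · subst hj; simp [refl]
  · simp [refl, hj]

/-- `T_M` is injective. [folklore] -/
private theorem refl_injective (M : ℤ) : Function.Injective (refl (d := d) M) := fun v w h => by
  rw [← refl_refl M v, h, refl_refl]

/-- `T_M` fixes the hyperplane `x₁ = M`. [folklore] -/
private theorem refl_of_eq {M : ℤ} {v : Site d} (h : v 0 = M) : refl M v = v := by
  funext j; by_cases hj : j = 0
  · subst hj; simp [refl, h]; ring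
  · simp [refl, hj]

/-- `T_M` preserves adjacency. [folklore] -/
private theorem refl_adj {M : ℤ} {v w : Site d} (h : (zdGraph d).Adj v w) : (zdGraph d).Adj (refl M v) (refl M w) := by
  rw [zdGraph_adj_iff] at h ⊢
  obtain ⟨i, hi⟩ := h
  refine ⟨i, ?_⟩
  by_cases hi0 : i = 0
  · subst hi0
    rcases hi with hi | hi
    · right; funext j; by_cases hj : j = 0
      · subst hj; simp [refl, hi]; ring
      · simp [refl, hj, hi]
    · left; funext j; by_cases hj : j = 0
      · subst hj; simp [refl, hi]; ring
      · simp [refl, hj, hi]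
  · rcases hi with hi | hi
    · left; funext j; by_cases hj : j = 0
      · subst hj; simp [refl, hi, Ne.symm hi0]
      · simp [refl, hj, hi]
    · right; funext j; by_cases hj : j = 0
      · subst hj; simp [refl, hi, Ne.symm hi0]
      · simp [refl, hj, hi]

/-! ### The maximal hyperplane and its first hitting time -/

/-- `M = max {υ₁(i) : 0 ≤ i ≤ N-1}` (junk `0` when `N = 0`). [cite: MadrasSlade1993, Proposition 8.1.2 (proof: `M`)] -/
def maxX (N : ℕ) (υ : ℕ → Site d) : ℤ :=
  if h : 0 < N then (range N).sup' (nonempty_range_iff.2 h.ne') (fun i => υ i 0) else 0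

/-- Every `υ₁(i)`, `i < N`, is at most `M`. [folklore] -/
private theorem le_maxX {N : ℕ} (υ : ℕ → Site d) {i : ℕ} (hi : i < N) : υ i 0 ≤ maxX N υ := by
  rw [maxX, dif_pos (by omega)]
  exact le_sup' (fun i => υ i 0) (mem_range.2 hi)

/-- `M` is attained before time `N`. [folklore] -/
private theorem exists_eq_maxX {N : ℕ} (hN : 0 < N) (υ : ℕ → Site d) : ∃ i, i < N ∧ υ i 0 = maxX N υ := by
  rw [maxX, dif_pos hN]
  obtain ⟨i, hi, h⟩ := exists_mem_eq_sup' (nonempty_range_iff.2 hN.ne') (fun i => υ i 0)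
  exact ⟨i, mem_range.1 hi, h.symm⟩

/-- `s`, the first time with `υ₁(s) = M` (junk `0` when `N = 0`). [cite: MadrasSlade1993, Proposition 8.1.2 (proof: `s`)] -/
def hitTime (N : ℕ) (υ : ℕ → Site d) : ℕ :=
  if h : 0 < N then Nat.find (exists_eq_maxX h υ) else 0

/-- Specification of `s`: `s < N`, `υ₁(s) = M`, `υ₁(i) < M` for `i < s`. [folklore] -/
private theorem hitTime_spec {N : ℕ} (hN : 0 < N) (υ : ℕ → Site d) :
    hitTime N υ < N ∧ υ (hitTime N υ) 0 = maxX N υ ∧ ∀ i < hitTime N υ, υ i 0 < maxX N υ := by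
  rw [hitTime, dif_pos hN]
  obtain ⟨hs, hse⟩ := Nat.find_spec (exists_eq_maxX hN υ)
  refine ⟨hs, hse, fun i hi => lt_of_le_of_ne (le_maxX υ (hi.trans hs)) fun h => ?_⟩
  exact Nat.find_min (exists_eq_maxX hN υ) hi ⟨hi.trans hs, h⟩

/-! ### The unfolding map -/

/-- `ψ`: the loop with the piece from its first visit `s` to the maximal hyperplane on reflected through it.
[cite: MadrasSlade1993, Proposition 8.1.2 (proof: `ψ`)] -/
def psi (N : ℕ) (υ : ℕ → Site d) (i : ℕ) : Site d :=
  if i < hitTime N υ then υ i else refl (maxX N υ) (υ i)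

/-- `ζ = φ ∘ ψ`: one step `e₁`, then (the translate of) `ψ` run for `N-1` steps; frozen after time `N`.
[cite: MadrasSlade1993, Proposition 8.1.2 (proof: `ζ ≡ φ ∘ ψ`)] -/
def unfold (N : ℕ) (υ : ℕ → Site d) (t : ℕ) : Site d :=
  if t = 0 then 0 else ee 0 + psi N υ (min (t - 1) (N - 1))

section Facts

variable {N : ℕ} {I : Fin d} {υ : ℕ → Site d}

/-- First coordinates of `ψ`: `0 ≤ ψ₁(i) ≤ 2M` for `i ≤ N-1`, `ψ₁(i) < M` for `i < s`, `M ≤ ψ₁(i)` for `s ≤ i ≤ N-1`.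
[cite: MadrasSlade1993, Proposition 8.1.2 (proof: "`ψ₁(i) < M` for all `i < s` and `ψ₁(i) ≥ M` for all `i ≥ s`")] -/
private theorem psi_fst (hυ : υ ∈ halfLoops d N I) (hN : 3 ≤ N) {i : ℕ} (hi : i ≤ N - 1) :
    0 ≤ psi N υ i 0 ∧ psi N υ i 0 ≤ 2 * maxX N υ ∧
      (i < hitTime N υ → psi N υ i 0 < maxX N υ) ∧ (hitTime N υ ≤ i → maxX N υ ≤ psi N υ i 0) := by
  obtain ⟨hs, hx0, -⟩ := mem_halfLoops'.1 hυ
  obtain ⟨-, -, hlt⟩ := hitTime_spec (show 0 < N by omega) υ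
  have hM0 : 0 ≤ maxX N υ := (hx0 0).trans (le_maxX υ (show 0 < N by omega))
  have hle := le_maxX υ (show i < N by omega)
  have h0i := hx0 i
  by_cases his : i < hitTime N υ
  · have := hlt i his
    simp only [psi, if_pos his]
    exact ⟨h0i, by linarith, fun _ => this, fun h => absurd his (not_lt.2 h)⟩
  · simp only [psi, if_neg his, refl_zero]
    exact ⟨by linarith, by linarith, fun h => absurd h his, fun _ => by linarith⟩

/-- `ψ` is a nearest-neighbour path on `[0, N-1]`. [cite: MadrasSlade1993, Proposition 8.1.2 (proof)] -/
private theorem psi_adj (hυ : υ ∈ halfLoops d N I) (hN : 3 ≤ N) {i : ℕ} (hi : i + 1 ≤ N - 1) :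
    (zdGraph d).Adj (psi N υ i) (psi N υ (i + 1)) := by
  obtain ⟨hs, -, -⟩ := mem_halfLoops'.1 hυ
  obtain ⟨-, -, hadj, -, -⟩ := loop_facts hs
  obtain ⟨-, hse, -⟩ := hitTime_spec (show 0 < N by omega) υ
  have h := hadj i (by omega)
  by_cases h1 : i + 1 < hitTime N υ
  · simp only [psi, if_pos h1, if_pos (show i < hitTime N υ by omega)]; exact h
  · by_cases h2 : i < hitTime N υ
    · have heq : i + 1 = hitTime N υ := by omega
      simp only [psi, if_pos h2, if_neg h1]
      rw [refl_of_eq (by rw [heq, hse])]; exact h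
    · simp only [psi, if_neg h2, if_neg h1]; exact refl_adj h

/-- `ψ` is injective on `[0, N-1]`. [cite: MadrasSlade1993, Proposition 8.1.2 (proof: "`ψ` is a self-avoiding walk")] -/
private theorem psi_injOn (hυ : υ ∈ halfLoops d N I) (hN : 3 ≤ N) : Set.InjOn (psi N υ) {i | i ≤ N - 1} := by
  obtain ⟨hs, -, -⟩ := mem_halfLoops'.1 hυ
  obtain ⟨-, -, -, -, hinj⟩ := loop_facts hs
  intro i hi i' hi' h
  simp only [Set.mem_setOf_eq] at hi hi'
  have hiN : i ∈ {i | i < N} := by simp only [Set.mem_setOf_eq]; omega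
  have hiN' : i' ∈ {i | i < N} := by simp only [Set.mem_setOf_eq]; omega
  by_cases h1 : i < hitTime N υ <;> by_cases h2 : i' < hitTime N υ
  · simp only [psi, if_pos h1, if_pos h2] at h; exact hinj hiN hiN' h
  · exfalso
    have a := ((psi_fst hυ hN hi).2.2.1 h1)
    have b := ((psi_fst hυ hN hi').2.2.2 (not_lt.1 h2))
    rw [h] at a; linarith
  · exfalso
    have a := ((psi_fst hυ hN hi').2.2.1 h2)
    have b := ((psi_fst hυ hN hi).2.2.2 (not_lt.1 h1))
    rw [h] at b; linarith
  · simp only [psi, if_neg h1, if_neg h2] at h; exact hinj hiN hiN' (refl_injective _ h)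

/-- The last site of `ψ`: `ψ(N-1) = T_M(e_I)`, so `ψ₁(N-1) = 2M` and the transverse part is that of `e_I`.
[cite: MadrasSlade1993, Proposition 8.1.2 (proof, eq. (8.1.22))] -/
private theorem psi_last (hυ : υ ∈ halfLoops d N I) (hN : 3 ≤ N) :
    psi N υ (N - 1) = refl (maxX N υ) (ee I) := by
  obtain ⟨-, -, hlast⟩ := mem_halfLoops'.1 hυ
  obtain ⟨hsN, hse, -⟩ := hitTime_spec (show 0 < N by omega) υ
  by_cases h : N - 1 < hitTime N υ
  · omega
  · simp only [psi, if_neg h, hlast]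

/-- **`ζ` is an `N`-step bridge from `0` whose endpoint has the transverse coordinates of `e_I`** (`υ ∈ Q_I[N]`,
`I ≠ 0`, `N ≥ 3`). [cite: MadrasSlade1993, Proposition 8.1.2 (proof: "`ζ ≡ φ ∘ ψ` is an `N`-step bridge", eq. (8.1.22))] -/
theorem unfold_mem (hυ : υ ∈ halfLoops d N I) (hI : I ≠ 0) (hN : 3 ≤ N) :
    unfold N υ ∈ bridges d N ∧ ∀ j : Fin d, j ≠ 0 → unfold N υ N j = ee I j := by
  have hM0 : 0 ≤ maxX N υ := by
    obtain ⟨-, hx0, -⟩ := mem_halfLoops'.1 hυ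
    exact (hx0 0).trans (le_maxX υ (show 0 < N by omega))
  have hval : ∀ t, 1 ≤ t → t ≤ N → unfold N υ t = ee 0 + psi N υ (t - 1) := fun t h1 h2 => by
    simp only [unfold, if_neg (show t ≠ 0 by omega), min_eq_left (show t - 1 ≤ N - 1 by omega)]
  have hlastv : unfold N υ N = ee 0 + refl (maxX N υ) (ee I) := by rw [hval N (by omega) le_rfl, psi_last hυ hN]
  refine ⟨mem_bridges.2 ⟨mem_saws.2 ⟨by simp [unfold], fun t ht => ?_, fun t ht => ?_, ?_⟩, fun t h1 h2 => ?_⟩,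
    fun j hj => ?_⟩
  · -- frozen
    simp only [unfold, if_neg (show t ≠ 0 by omega), if_neg (show N ≠ 0 by omega),
      min_eq_right (show N - 1 ≤ t - 1 by omega), min_eq_right (le_refl (N - 1))]
  · -- steps
    rcases Nat.eq_zero_or_pos t with rfl | hpos
    · rw [hval 1 le_rfl (by omega), zdGraph_adj_iff]
      refine ⟨0, Or.inl ?_⟩
      obtain ⟨hs, -, -⟩ := mem_halfLoops'.1 hυ
      obtain ⟨h0, -⟩ := loop_facts hs
      have : psi N υ 0 = 0 := by
        by_cases h : 0 < hitTime N υ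
        · simp only [psi, if_pos h, h0]
        · obtain ⟨-, hse, -⟩ := hitTime_spec (show 0 < N by omega) υ
          have hs0 : hitTime N υ = 0 := by omega
          simp only [psi, if_neg h]
          rw [refl_of_eq (by rw [← hs0, hse])]; exact h0
      simp [unfold, this, ee]
    · rw [hval t hpos (by omega), hval (t + 1) (by omega) (by omega), show t + 1 - 1 = t - 1 + 1 by omega]
      have := psi_adj hυ hN (i := t - 1) (by omega)
      rw [zdGraph_adj_iff] at this ⊢
      obtain ⟨i, hi | hi⟩ := this
      · exact ⟨i, Or.inl (by rw [hi]; abel)⟩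
      · exact ⟨i, Or.inr (by rw [hi]; abel)⟩
  · -- injective on `[0, N]`
    intro t ht t' ht' h
    simp only [Set.mem_setOf_eq] at ht ht'
    have key : ∀ t, 1 ≤ t → t ≤ N → 1 ≤ unfold N υ t 0 := fun t h1 h2 => by
      rw [hval t h1 h2]
      have := (psi_fst hυ hN (i := t - 1) (by omega)).1
      simp [ee]; linarith
    rcases Nat.eq_zero_or_pos t with rfl | hpos <;> rcases Nat.eq_zero_or_pos t' with rfl | hpos'
    · rfl
    · exfalso; have := key t' hpos' ht'; rw [← h] at this; simp [unfold] at this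
    · exfalso; have := key t hpos ht; rw [h] at this; simp [unfold] at this
    · rw [hval t hpos ht, hval t' hpos' ht'] at h
      have h' := psi_injOn hυ hN (show t - 1 ∈ {i | i ≤ N - 1} by simp only [Set.mem_setOf_eq]; omega)
        (show t' - 1 ∈ {i | i ≤ N - 1} by simp only [Set.mem_setOf_eq]; omega) (add_left_cancel h)
      omega
  · -- bridge
    have h := psi_fst hυ hN (i := t - 1) (by omega)
    have hz : unfold N υ 0 = 0 := by simp [unfold]
    rw [hval t h1 h2, hlastv, hz]
    have hI0 : (ee I : Site d) 0 = 0 := by simp [ee, Pi.single_eq_of_ne (Ne.symm hI)]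
    have he : (ee (0 : Fin d) : Site d) 0 = 1 := by simp [ee]
    simp only [Pi.add_apply, refl_zero, hI0, Pi.zero_apply, he]
    constructor <;> linarith [h.1, h.2.1]
  · rw [hlastv, Pi.add_apply, refl_ne _ _ hj]
    simp [ee, Pi.single_eq_of_ne hj]

/-- **`ζ` determines the polygon**: `unfold N` is injective on `Q_I[N]`.
[cite: MadrasSlade1993, Proposition 8.1.2 (proof: "`ζ` uniquely determines the original polygon")] -/
theorem unfold_injOn (hN : 3 ≤ N) : Set.InjOn (unfold (d := d) N) ↑(halfLoops d N I) := by
  intro υ hυ υ' hυ' h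
  have hυm := Finset.mem_coe.1 hυ
  have hυm' := Finset.mem_coe.1 hυ'
  have hval : ∀ (υ : ℕ → Site d) t, 1 ≤ t → t ≤ N → unfold N υ t = ee 0 + psi N υ (t - 1) := fun υ t h1 h2 => by
    simp only [unfold, if_neg (show t ≠ 0 by omega), min_eq_left (show t - 1 ≤ N - 1 by omega)]
  -- `ψ = ψ'` on `[0, N-1]`
  have hpsi : ∀ i, i ≤ N - 1 → psi N υ i = psi N υ' i := fun i hi => by
    have := congrFun h (i + 1)
    rw [hval υ (i + 1) (by omega) (by omega), hval υ' (i + 1) (by omega) (by omega), Nat.add_sub_cancel] at this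
    exact add_left_cancel this
  -- `M = M'` from the endpoint
  have hM : maxX N υ = maxX N υ' := by
    have h1 := congrFun (hpsi (N - 1) le_rfl) 0
    rw [psi_last hυm hN, psi_last hυm' hN, refl_zero, refl_zero] at h1
    linarith
  -- `s = s'`
  obtain ⟨hsN, hse, hlt⟩ := hitTime_spec (show 0 < N by omega) υ
  obtain ⟨hsN', hse', hlt'⟩ := hitTime_spec (show 0 < N by omega) υ'
  have hS : hitTime N υ = hitTime N υ' := by
    by_contra hne
    rcases lt_or_gt_of_ne hne with hss | hss
    · -- at time `s`: `ψ₁(s) = M` but `ψ'₁(s) = υ'₁(s) < M`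
      have a := (psi_fst hυm hN (i := hitTime N υ) (by omega)).2.2.2 le_rfl
      have b := (psi_fst hυm' hN (i := hitTime N υ) (by omega)).2.2.1 hss
      rw [hpsi _ (by omega), hM] at a; linarith
    · have a := (psi_fst hυm' hN (i := hitTime N υ') (by omega)).2.2.2 le_rfl
      have b := (psi_fst hυm hN (i := hitTime N υ') (by omega)).2.2.1 hss
      rw [← hpsi _ (by omega), ← hM] at a; linarith
  -- pointwise
  obtain ⟨hs, -, -⟩ := mem_halfLoops'.1 hυm
  obtain ⟨hs', -, -⟩ := mem_halfLoops'.1 hυm'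
  obtain ⟨-, hfr, -, hNz, -⟩ := loop_facts hs
  obtain ⟨-, hfr', -, hNz', -⟩ := loop_facts hs'
  funext i
  rcases lt_or_ge i N with hi | hi
  · have hp := hpsi i (by omega)
    by_cases his : i < hitTime N υ
    · simpa only [psi, if_pos his, if_pos (hS ▸ his)] using hp
    · simp only [psi, if_neg his, if_neg (hS ▸ his), hM] at hp
      exact refl_injective _ hp
  · rw [hfr i hi, hfr' i hi, hNz, hNz']

end Facts

end PolygonBridge

/-! ## Theorems -/

section Theorems

variable [NeZero d]

open PolygonBridge PolygonConcat

/-- **`#Q_I[N] ≤ b_N(e_I)`** (`I ≠ 0`, `N ≥ 3`): the unfolding `ζ` injects the half-space polygons through the bond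
`{0, e_I}` into the `N`-step bridges ending next to the `x₁`-axis in direction `e_I`.
[cite: MadrasSlade1993, Proposition 8.1.2 (proof, eq. (8.1.23))] -/
theorem card_halfLoops_le_bridgeEndCount {N : ℕ} (hN : 3 ≤ N) {I : Fin d} (hI : I ≠ 0) :
    (halfLoops d N I).card ≤ bridgeEndCount d N (ee I) := by
  classical
  rw [bridgeEndCount]
  refine Finset.card_le_card_of_injOn (PolygonBridge.unfold N) (fun υ hυ => ?_) (unfold_injOn (I := I) hN)
  obtain ⟨h1, h2⟩ := unfold_mem hυ hI hN
  exact Finset.mem_filter.2 ⟨h1, h2⟩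

/-- **Madras–Slade Proposition 8.1.2** (eq. (8.1.19)), sharpened constant: for `N ≥ 3` and any coordinate direction
`I ≠ 0`, `q_N ≤ (d-1) · b_N(e_I)` — there are fewer `N`-step self-avoiding polygons (up to translation) than bridges
ending at a nearest neighbour of the `x₁`-axis (printed with the constant `d(d-1)` and for even `N ≥ 4`; odd `N` and
`N < 4` are trivial since then `q_N = 0`). Proof as printed (Figure 8.1): cut the polygon at the lexicographically
smallest site, reflect the piece after the first visit to the maximal hyperplane `x₁ = M` through it, prepend `e₁`;
combined with (3.2.4) `q_N ≤ (d-1) #Q_I[N]` of `SAWPolygonConcatenation.lean` instead of (8.1.20).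
[cite: MadrasSlade1993, Proposition 8.1.2 (p. 260, eq. (8.1.19); proof pp. 260–262, Figure 8.1 p. 261)] -/
theorem MadrasSlade1993_prop812 {N : ℕ} (hN : 3 ≤ N) {I : Fin d} (hI : I ≠ 0) :
    polygonNumber d N ≤ (d - 1) * bridgeEndCount d N (ee I) :=
  (polygonNumber_le hN hI).trans (Nat.mul_le_mul_left _ (card_halfLoops_le_bridgeEndCount hN hI))

/-- **`q_N ≤ (d-1) b_N`** for all `N` (`d ≥ 2`): polygons are outnumbered by bridges, up to the factor `d-1`.
[cite: MadrasSlade1993, Proposition 8.1.2 (p. 260, eq. (8.1.19); consequence with `b_N(w) ≤ b_N`)] -/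
theorem polygonNumber_le_mul_bridgeCount (hd : 2 ≤ d) (N : ℕ) :
    polygonNumber d N ≤ (d - 1) * bridgeCount d N := by
  classical
  have hI : (⟨1, by omega⟩ : Fin d) ≠ 0 := by simp [Fin.ext_iff]
  rcases lt_or_ge N 3 with hN | hN
  · -- `q_N = 0` for `N ≤ 2`: a self-avoiding loop has at least `4` steps... we only need `polygonReps = ∅`
    have h0 : polygonNumber d N = 0 := by
      rw [polygonNumber, Finset.card_eq_zero, polygonReps, Finset.filter_eq_empty_iff]
      intro ω hω hlt
      rw [canonLoops, Finset.mem_filter] at hω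
      obtain ⟨h0, hfr, -, hNz, -⟩ := PolygonBridge.loop_facts hω.1
      have heq : ω 1 = ω (N - 1) := by
        interval_cases N
        · exact hfr 1 (by omega)
        · show ω 1 = ω 0
          rw [hNz, h0]
        · rfl
      rw [heq] at hlt
      exact lt_irrefl _ hlt
    rw [h0]; exact Nat.zero_le _
  · exact (MadrasSlade1993_prop812 hN hI).trans
      (Nat.mul_le_mul_left _ (bridgeEndCount_le_bridgeCount N _))

/-- **In the plane, `q_N ≤ b_N`**: there are no more `N`-step self-avoiding polygons (up to translation) than
`N`-step bridges. [cite: MadrasSlade1993, Proposition 8.1.2 (p. 260, eq. (8.1.19) at `d = 2`)] -/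
theorem polygonNumber_two_le_bridgeCount (N : ℕ) : polygonNumber 2 N ≤ bridgeCount 2 N := by
  simpa using polygonNumber_le_mul_bridgeCount (d := 2) le_rfl N

end Theorems

end Literature.Probability.RandomPlanarGeometry.SAW.Zd

end
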